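import Summits.BirchSwinnertonDyer.BirchSwinnertonDyer.Theorems.ByReductionTypeAtTwoAdditiveKatoTransportDescentModelDoors
import Summits.BirchSwinnertonDyer.BirchSwinnertonDyer.Theorems.ByReductionTypeAtTwoAdditiveKatoTransportDescentNegTwoModelDoors
import Literature.NumberTheory.EllipticCurves.ComplexMultiplication
import Literature.NumberTheory.EllipticCurves.TateModuleContinuityProofs
import HarnessLib

/-!
# Route ByReductionTypeAtTwo, crux `AdditiveRankZeroAtTwo` (stmt-BirchSwinnertonDyer-19098), child C4″ `AdditivePotMultOverKAtTwo`
# (stmt-BirchSwinnertonDyer-22618) — the Iwasawa-level END theorems of the two split-twist blocks in `W`-ONLY form: for a globally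
# minimal `W/ℚ` whose twist by `−1` (resp. `−2`) is split multiplicative at `2` and `L(W,1) ≠ 0`, and for EVERY cyclotomic datum
# `(κ, γ)` and EVERY newform `f` of the twist, `∃ L̃ ∈ Λ`, `ι L̃ = L⁻₂(f)`, `L̃ ≠ 0`, with `ℓ_𝔮(X(W/ℚ_∞)) ≤ ℓ_𝔮(Λ/(L̃))` at every
# height-one `𝔮 ∌ 2` (key `γ`, key `γ⁻¹`, every `W₁ ∼_ℚ W`) — the auxiliary model `W′`, the change of variables `V`, the instance
# `ContinuousSMul ℤ₂ T₂W` and `r_an(W) = 0` of the END theorems DISCHARGED (theorems only)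

Cell `bsd-2adic` (run/shared/lean/pub/bsd-2adic/), seat `bsd-2adic-addL2x` GEN 18 (repair-census entry R-B81 «descent socket»,
part 1 of 3). The END theorems `AddKatoTwo.katoDivisibility_negOneSplitTwist_two_of_descent_of_analyticRank_eq_zero` (addL2x
GEN 17, p727658) and `AddKatoTwo.katoDivisibility_negTwoSplitTwist_two_of_descent_of_analyticRank_eq_zero` (k4-w3 GEN 8, p728952)
carry, besides `W`, the data `(W′, V, hV : V • W = W′^{(d)})` (a globally minimal model of the twist), the instance binder
`[ContinuousSMul ℤ_[2] (W.tateModule 2)]` and the hypothesis `W.analyticRank = 0`. All four are free: `W^{(d)}` has a globally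
minimal model `W′ = C₀ • W^{(d)}` (`hasGlobalMinimalModel_rat_holds`, Silverman *AEC* VIII.8.3) and then
`W′^{(d)} = (C₀.u, d·C₀.r, 0, 0) • (W^{(d)})^{(d)} = (…) • W^{(d²)} ≅ W` (`quadraticTwist_smul`, `quadraticTwist_quadraticTwist`,
`exists_variableChange_quadraticTwist_one`); the instance is `TateModule.continuousSMul_padicInt`; `r_an(W) = 0` is
`L(W,1) ≠ 0` (`analyticRank_eq_zero_of_entireLFunction_one_ne_zero`, the order of vanishing of an entire function). So the
Iwasawa-level output of the Literature CONSTRUCTION fact `Kato2004.exists_splitTwistDivisibilityInputsDescent_negOne_two` (odd-branch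
descent package; audit-2 sheet hDescTw PASS) + PRINT {`Kato2004.thm12_4`, Greenberg Thm. 1.14 over `ℚ` and over `ℚ(√d)`, Greenberg
Thm. 1.5, modularity} becomes a statement about `W` ALONE, quantified over every `(κ, γ, f)` — the shape in which the crux's
residual consumes it (parts 2–3: `…AdditiveKatoDescentSocketDefs.lean`, `…AdditiveRankZeroResidualV12.lean`).

* `katoDivisibility_negOneSplitTwist_two_of_descent_of_L_one_ne_zero` — the (−1)-block, `L⁻₂(f) = padicLFunctionMinusBranchMult f 1 1`.
* `katoDivisibility_negTwoSplitTwist_two_of_descent_of_L_one_ne_zero` — the (−2)-block,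
  `L⁻₂(f) = padicLFunctionMinusBranchMultTwist f 1 1 (−1)` (the `ω·χ₂`-branch).
* `exists_isGloballyMinimal_smul_eq_quadraticTwist` — the model lemma used by both.

PROOFS: re-derived from the MODEL-door level (`…DescentModelDoors.lean` p727444, `…DescentNegTwoModelDoors.lean` p727858: the
doors modulo the Selmer model over `F = ℚ(√d)`) exactly as the END files do (model SUPPLIED by t42's
`AddKatoTwoQuadLayerModel.exists_selmerInfty_model` / `AddKatoTwoQuadLayerTwist.exists_selmerInfty_model_of_sq_eq`, `hF` by
`hasSplitMultiplicativeReductionAt_baseChange_of_two_mem`, the WLOG on the generator by `exists_mem_kerSubgroup_cyclotomicCharacter_mul_eq_five`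
resp. `exists_mem_kerSubgroup_smul_sqrt_eq_neg_of_neg` + the rekey lemmas `forall_selmerDualData_of_rekey` / `…_inv_of_mul`), because the
two END modules themselves (accepted 15:22Z) had no farm olean during the 2026-08-29 15:4xZ K4-cone outage; once built,
`katoDivisibility_neg{One,Two}SplitTwist_two_of_descent_of_analyticRank_eq_zero` give the same statements in one line each.

HONEST FRAMING (D-0036 / D-0054): theorems only — no definition, no named fact, no instance, no `sorry`; CONDITIONAL on the five
PRINT facts and the one Literature construction fact named in the signatures (all consumed BY NAME); types-the-object-of; closes
none; nothing booked; BSD is not proved by any of this. PARTITION: X5@2 additive potentially-multiplicative block, the (−1)-split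
(169 classes) and (−2)-split (39 classes) sub-blocks × `p = 2`.

References: [Kato2004Asterisque] Thm. 12.4 (p. 221), Thm. 12.5 (3) with (12.5.1) (p. 222), Lemma 17.12 (pp. 278–279), §17.13
(pp. 279–280); [GreenbergLNM1716] §1 (p. 60), Thm. 1.5 (p. 61), Thm. 1.14 (p. 68); [SilvermanAEC2009] VIII.8 Cor. 8.3, X.5
Cor. 5.4; [BirchSwinnertonDyer1965] (order of vanishing); memo `run/shared/lean/pub/bsd-2adic/addL2x/VERDICT-19098-addL2x-GEN18.md`.
-/

set_option autoImplicit false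
-- the summit's namespace `Summit.BirchSwinnertonDyer.BirchSwinnertonDyer` (Sub = Summit) trips `dupNamespace`
set_option linter.dupNamespace false

noncomputable section

open scoped Classical MatrixGroups ModularForm NumberField

open Field CongruenceSubgroup WeierstrassCurve IsDedekindDomain Literature.NumberTheory.EllipticCurves
  Literature.NumberTheory.EllipticCurves.ModularForms Literature.NumberTheory.EllipticCurves.IwasawaAlgebra
  Literature.NumberTheory.EllipticCurves.Module Literature.NumberTheory.EllipticCurves.QuadraticLayer
  Literature.NumberTheory.EllipticCurves.Greenberg1999 Literature.NumberTheory.GaloisRepresentations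
  Summit.BirchSwinnertonDyer.BirchSwinnertonDyer.Theorems

namespace Summit.BirchSwinnertonDyer.BirchSwinnertonDyer.Theorems.AddKatoTwo

/-! ## §0 The globally minimal model of a quadratic twist, presented as `V • W = W′^{(d)}` -/

/-- **A globally minimal model `W′` of `W^{(d)}` with `V • W = W′^{(d)}`** (`d = ±1, ±2, …`, any `d ≠ 0`): `W^{(d)}` is elliptic
(`isElliptic_quadraticTwist`) and has a globally minimal model `W′ = C₀ • W^{(d)}` over `ℚ` (class number one; Silverman *AEC*
VIII.8.3, tree `hasGlobalMinimalModel_rat_holds`); twisting commutes with changes of variables up to the explicit change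
`(C₀.u, d·C₀.r, 0, 0)` (`quadraticTwist_smul`), `(W^{(d)})^{(d)} = W^{(d²)}` (`quadraticTwist_quadraticTwist`) and `W^{(d²)} ≅ W^{(1)} ≅ W`
(`exists_variableChange_quadraticTwist_mul_sq`, `exists_variableChange_quadraticTwist_one`). This is the data binder `(W′, V, hV)` of the
cell's split-twist END theorems. [cite: SilvermanAEC2009, VIII.8 Cor. 8.3 and X.5 Cor. 5.4] -/
theorem exists_isGloballyMinimal_smul_eq_quadraticTwist (W : WeierstrassCurve ℚ) [W.IsElliptic] {d : ℚ} (hd : d ≠ 0) :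
    ∃ (W' : WeierstrassCurve ℚ) (_ : W'.IsElliptic) (_ : W'.IsGloballyMinimal) (V : VariableChange ℚ),
      V • W = W'.quadraticTwist d := by
  haveI hEd : (W.quadraticTwist d).IsElliptic := W.isElliptic_quadraticTwist hd
  obtain ⟨C₀, hC₀⟩ := hasGlobalMinimalModel_rat_holds (W.quadraticTwist d)
  -- `W ≅ W^{(1)} ≅ W^{(1·d²)} = W^{(d·d)}` (the twist class depends on `d` mod squares; Silverman X.5.4)
  obtain ⟨C₁, hC₁⟩ := W.exists_variableChange_quadraticTwist_one
  obtain ⟨C₂, hC₂⟩ := W.exists_variableChange_quadraticTwist_mul_sq 1 d hd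
  refine ⟨C₀ • W.quadraticTwist d, inferInstance, hC₀, (⟨C₀.u, d * C₀.r, 0, 0⟩ : VariableChange ℚ) * (C₂ * C₁), ?_⟩
  rw [quadraticTwist_smul, quadraticTwist_quadraticTwist, show d * d = 1 * d ^ 2 by ring, ← hC₂, ← hC₁, mul_smul, mul_smul]

/-! ## §1 The (−1)-block END theorem in `W`-only form -/

/-- **Kato's one-sided divisibility at `2` for the ADDITIVE `W` whose twist by `−1` is split multiplicative at `2`, in `W`-ONLY
form.** For `W/ℚ` globally minimal with `W^{(−1)}` split multiplicative at `2` and `L(W,1) ≠ 0`, GIVEN (PRINT, BY NAME)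
`Kato2004.thm12_4`, Greenberg LNM 1716 Thm. 1.14 over `ℚ` (`Greenberg1999_thm114_charIdeal_iota_invariant`) and over the quadratic
field (`thm114_charIdeal_iota_invariant_splitMult_baseChange`), Greenberg Thm. 1.5 (`thm15_isTorsion_multiplicative_rat`), modularity
(`hasEntireLFunction_rat`), and the Literature CONSTRUCTION fact `Kato2004.exists_splitTwistDivisibilityInputsDescent_negOne_two` (the
odd-branch §17.13 descent package at `2`): for EVERY cyclotomic `κ`, every topological generator `γ` matching the cyclotomic variable,
every newform `f` of `W^{(−1)}`, there is `L̃ ∈ Λ = ℤ₂⟦T⟧` with `ι L̃ = L⁻₂(f, 1, ω, T)` (`padicLFunctionMinusBranchMult f 1 1`), `L̃ ≠ 0`,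
and (i) `ℓ_𝔮(D.X) ≤ ℓ_𝔮(Λ/(L̃))` at every height-one `𝔮 ∌ 2` for every key-`γ` dual Selmer datum `D` of `W`, (ii) the same for every
key-`γ⁻¹` datum, (iii) the same for every key-`γ` datum of every `W₁` isogenous to `W` over `ℚ`. This is the statement of
`katoDivisibility_negOneSplitTwist_two_of_descent_of_analyticRank_eq_zero` (addL2x GEN 17) with its data `(W′, V, hV)` supplied by
`exists_isGloballyMinimal_smul_eq_quadraticTwist`, its instance binder by `TateModule.continuousSMul_padicInt`, and `r_an(W) = 0` replaced by
`L(W,1) ≠ 0`; proof re-run from the Model-door level (module docstring). [cite: Kato2004Asterisque, Thm. 12.4 (p. 221), Thm. 12.5 (3) and (12.5.1) (p. 222), Lemma 17.12 (pp. 278–279), §17.13 (pp. 279–280)]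
[cite: GreenbergLNM1716, Thm. 1.5 (p. 61), Thm. 1.14 (p. 68)] [cite: SilvermanAEC2009, VIII.8 Cor. 8.3] -/
theorem katoDivisibility_negOneSplitTwist_two_of_descent_of_L_one_ne_zero (h12 : Kato2004.thm12_4)
    (hDesc : Kato2004.exists_splitTwistDivisibilityInputsDescent_negOne_two)
    (h114 : Greenberg1999_thm114_charIdeal_iota_invariant)
    (h114F : Greenberg1999.thm114_charIdeal_iota_invariant_splitMult_baseChange) (h15 : thm15_isTorsion_multiplicative_rat)
    (hmod : hasEntireLFunction_rat)
    (W : WeierstrassCurve ℚ) [W.IsElliptic] [W.IsGloballyMinimal]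
    (hsp : (W.quadraticTwist (-1)).HasSplitMultiplicativeReductionAtPrime 2) (hL : W.entireLFunction 1 ≠ 0)
    (κ : ZpExtension ℚ 2) (γ : absoluteGaloisGroup ℚ) (hκ : κ.IsCyclotomic) (hγ : κ.IsTopGenerator γ)
    (hγ' : IsCyclotomicVariable 2 γ) {N : ℕ} [NeZero N] (f : CuspForm (Gamma0 N) 2)
    (hf : IsNewformOf (W.quadraticTwist (-1)) f) :
    ∃ Lt : IwasawaAlgebra 2, iwasawaToPowerSeries 2 Lt = padicLFunctionMinusBranchMult f (1 : ℚ_[2]) 1 ∧ Lt ≠ 0 ∧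
    (∀ (D : W.SelmerDualData κ γ) (𝔮 : PrimeSpectrum (IwasawaAlgebra 2)), 𝔮.asIdeal.height = 1 →
      PowerSeries.C (2 : ℤ_[2]) ∉ 𝔮.asIdeal →
      lengthAt (IwasawaAlgebra 2) D.X 𝔮 ≤ lengthAt (IwasawaAlgebra 2) (IwasawaAlgebra 2 ⧸ Ideal.span {Lt}) 𝔮) ∧
    (∀ (D' : W.SelmerDualData κ γ⁻¹) (𝔮 : PrimeSpectrum (IwasawaAlgebra 2)), 𝔮.asIdeal.height = 1 →
      PowerSeries.C (2 : ℤ_[2]) ∉ 𝔮.asIdeal →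
      lengthAt (IwasawaAlgebra 2) D'.X 𝔮 ≤ lengthAt (IwasawaAlgebra 2) (IwasawaAlgebra 2 ⧸ Ideal.span {Lt}) 𝔮) ∧
    (∀ (W₁ : WeierstrassCurve ℚ) [W₁.IsElliptic], IsIsogenous W W₁ →
      ∀ (D₁ : W₁.SelmerDualData κ γ) (𝔮 : PrimeSpectrum (IwasawaAlgebra 2)), 𝔮.asIdeal.height = 1 →
      PowerSeries.C (2 : ℤ_[2]) ∉ 𝔮.asIdeal →
      lengthAt (IwasawaAlgebra 2) D₁.X 𝔮 ≤ lengthAt (IwasawaAlgebra 2) (IwasawaAlgebra 2 ⧸ Ideal.span {Lt}) 𝔮) := by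
  haveI : Fact (Nat.Prime 2) := ⟨Nat.prime_two⟩
  haveI : ContinuousSMul ℤ_[2] (W.tateModule 2) := TateModule.continuousSMul_padicInt
  haveI : (W.quadraticTwist (-1 : ℚ)).IsElliptic := W.isElliptic_quadraticTwist (by norm_num)
  obtain ⟨W', _, _, V, hV⟩ := exists_isGloballyMinimal_smul_eq_quadraticTwist W (d := -1) (by norm_num)
  -- (α) the odd-branch integral lift `L̃`: `W ≅ (W^{(−1)})^{(−1)}`, `W^{(−1)}` split multiplicative with newform `f`
  have hWtw : ∃ C : VariableChange ℚ, C • (W.quadraticTwist (-1 : ℚ)).quadraticTwist (-1) = W := by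
    obtain ⟨C, hC⟩ := W.exists_variableChange_quadraticTwist_one
    exact ⟨C⁻¹, by rw [quadraticTwist_quadraticTwist, show (-1 : ℚ) * -1 = 1 by norm_num, ← hC, inv_smul_smul]⟩
  obtain ⟨Lt, hLt, hLt0⟩ := exists_iwasawa_lift_oddBranch_ne_zero W (W.quadraticTwist (-1 : ℚ)) hWtw hf hsp hmod hL
  have hLt' : iwasawaToPowerSeries 2 Lt = padicLFunctionMinusBranchMult f (1 : ℚ_[2]) 1 := by
    rw [hLt, pow_zero, map_one, one_mul]
  -- (β) a model `F` of `ℚ(√−1)`, a square root `θ` of `−1` in `ℚ̄`, and `W′` split multiplicative above `2` over `F`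
  obtain ⟨F, _, _, θF, hθF, hF2⟩ := exists_numberField_sq_eq_of_neg (d := -1) (by norm_num)
  rw [map_neg, map_one] at hθF
  obtain ⟨θ, hθ⟩ := AddKatoTwoQuadLayer.exists_sqrt (-1)
  haveI : (kerStab κ θ).Normal := normal_kerStab κ hθ
  have hsp' : W'.HasSplitMultiplicativeReductionAtPrime 2 :=
    hasSplitMultiplicativeReductionAtPrime_twistModel W W' (by norm_num) hV 2 hsp
  have hF : ∀ v : HeightOneSpectrum (𝓞 F), (2 : 𝓞 F) ∈ v.asIdeal → (W'.baseChange F).HasSplitMultiplicativeReductionAt v :=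
    fun v hv ↦ AddKatoTwoQuadLayerModel.hasSplitMultiplicativeReductionAt_baseChange_of_two_mem W' hsp' F v hv
  -- (γ) the three clauses at every generator `γ₀` with `κ_cyc(γ₀) = 5`: the model over `F` SUPPLIED, then the Model doors
  have key : ∀ γ₀ : absoluteGaloisGroup ℚ, κ.IsTopGenerator γ₀ →
      ((GaloisRep.cyclotomicCharacter ℚ 2 γ₀ : ℤ_[2]ˣ) : ℤ_[2]) = (cyclotomicGenerator 2 : ℤ_[2]) →
      (∀ (D : W.SelmerDualData κ γ₀) (𝔮 : PrimeSpectrum (IwasawaAlgebra 2)), 𝔮.asIdeal.height = 1 →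
        PowerSeries.C (2 : ℤ_[2]) ∉ 𝔮.asIdeal →
        lengthAt (IwasawaAlgebra 2) D.X 𝔮 ≤ lengthAt (IwasawaAlgebra 2) (IwasawaAlgebra 2 ⧸ Ideal.span {Lt}) 𝔮) ∧
      (∀ (D' : W.SelmerDualData κ γ₀⁻¹) (𝔮 : PrimeSpectrum (IwasawaAlgebra 2)), 𝔮.asIdeal.height = 1 →
        PowerSeries.C (2 : ℤ_[2]) ∉ 𝔮.asIdeal →
        lengthAt (IwasawaAlgebra 2) D'.X 𝔮 ≤ lengthAt (IwasawaAlgebra 2) (IwasawaAlgebra 2 ⧸ Ideal.span {Lt}) 𝔮) ∧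
      (∀ (W₁ : WeierstrassCurve ℚ) [W₁.IsElliptic], IsIsogenous W W₁ →
        ∀ (D₁ : W₁.SelmerDualData κ γ₀) (𝔮 : PrimeSpectrum (IwasawaAlgebra 2)), 𝔮.asIdeal.height = 1 →
        PowerSeries.C (2 : ℤ_[2]) ∉ 𝔮.asIdeal →
        lengthAt (IwasawaAlgebra 2) D₁.X 𝔮 ≤ lengthAt (IwasawaAlgebra 2) (IwasawaAlgebra 2 ⧸ Ideal.span {Lt}) 𝔮) := by
    intro γ₀ hγ₀ hγ₀5
    obtain ⟨I⟩ := Kato2004.nonempty_iwasawaH1Data_holds W 2 κ γ₀ hκ hγ₀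
    have hγθ : γ₀ • θ = θ := smul_eq_self_of_sq_eq_neg_one_of_cyclotomicCharacter_eq_five hγ₀5 hθ
    obtain ⟨κF, γF, hκF, hγF, -, -, ΘS, hΘS⟩ :=
      AddKatoTwoQuadLayerModel.exists_selmerInfty_model κ hκ W' hθ hγ₀ hγθ F hθF hF2
    have hD : ∀ (D : W.SelmerDualData κ γ₀) (𝔮 : PrimeSpectrum (IwasawaAlgebra 2)), 𝔮.asIdeal.height = 1 →
        PowerSeries.C (2 : ℤ_[2]) ∉ 𝔮.asIdeal →
        lengthAt (IwasawaAlgebra 2) D.X 𝔮 ≤ lengthAt (IwasawaAlgebra 2) (IwasawaAlgebra 2 ⧸ Ideal.span {Lt}) 𝔮 :=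
      lengthAt_selmerDual_le_of_splitTwistDescent_fe_of_model W W' hV hθ f κ γ₀ hsp hκ hγ₀ hγ₀5 hf I F hF κF γF hκF hγF
        ((W'.baseChange F).selmerDualData κF hγF) ΘS hΘS Lt 0 hLt hLt0 h12 hDesc h114 h114F h15
    refine ⟨hD, ?_, ?_⟩
    · exact lengthAt_selmerDualContra_le_of_splitTwistDescent_fe_of_model W W' hV hθ f κ γ₀ hsp hκ hγ₀ hγ₀5 hf I F hF κF γF
        hκF hγF ((W'.baseChange F).selmerDualData κF hγF) ΘS hΘS Lt 0 hLt hLt0 h12 hDesc h114 h114F h15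
    · intro W₁ _ hiso D₁ 𝔮 h𝔮 hp𝔮
      have hp𝔮' : PowerSeries.C ((2 : ℕ) : ℤ_[2]) ∉ 𝔮.asIdeal := by exact_mod_cast hp𝔮
      rw [← lengthAt_selmerDual_eq_of_isIsogenous hiso (W.selmerDualData κ hγ₀) D₁ 𝔮 hp𝔮']
      exact hD (W.selmerDualData κ hγ₀) 𝔮 h𝔮 hp𝔮
  -- (δ) the WLOG `κ_cyc(γ·c) = 5`, `c ∈ ker κ` a complex conjugation, then every datum re-keyed
  refine ⟨Lt, hLt', hLt0, ?_⟩
  obtain ⟨c, hc, hγc5⟩ := exists_mem_kerSubgroup_cyclotomicCharacter_mul_eq_five κ hγ'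
  obtain ⟨h1, h2, h3⟩ := key (γ * c) (isTopGenerator_mul_of_mem_kerSubgroup κ hγ hc) hγc5
  have h2c : PowerSeries.C ((2 : ℕ) : ℤ_[2]) = PowerSeries.C (2 : ℤ_[2]) := by norm_num
  refine ⟨?_, ?_, ?_⟩
  · have h := forall_selmerDualData_of_rekey (W₀ := W) Lt hc (by simpa only [h2c] using h1)
    simpa only [h2c] using h
  · have h := forall_selmerDualData_inv_of_mul (W₀ := W) Lt hc (by simpa only [h2c] using h2)
    simpa only [h2c] using h
  · intro W₁ _ hiso
    have h := forall_selmerDualData_of_rekey (W₀ := W₁) Lt hc (by simpa only [h2c] using h3 W₁ hiso)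
    simpa only [h2c] using h

/-! ## §2 The (−2)-block END theorem in `W`-only form -/

/-- **Kato's one-sided divisibility at `2` for the ADDITIVE `W` whose twist by `−2` is split multiplicative at `2`, in `W`-ONLY
form** — the (−2)-block twin of `katoDivisibility_negOneSplitTwist_two_of_descent_of_L_one_ne_zero`, with `L⁻₂(f, 1, ω·χ₂, T)`
(`padicLFunctionMinusBranchMultTwist f 1 1 (−1)`, the `Γ`-twist by `u = −1` of the odd branch) for a newform `f` of `W^{(−2)}`:
the statement of k4-w3's `katoDivisibility_negTwoSplitTwist_two_of_descent_of_analyticRank_eq_zero` (p728952; the (−1) construction fact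
reaches the (−2) package through the kernel transport `AddKatoTwoGammaTwist.exists_splitTwistDescent_negTwo_two_of_negOne`, p726855) with
`(W′, V, hV)`, the instance and `r_an(W) = 0` discharged as in §1; proof re-run from k4-w3's Model-door level (module docstring).
[cite: Kato2004Asterisque, Thm. 12.4 (p. 221), Thm. 12.5 (3) and (12.5.1) (p. 222), §17.13 (pp. 279–280)]
[cite: GreenbergLNM1716, Thm. 1.5 (p. 61), Thm. 1.14 (p. 68)] [cite: MazurTateTeitelbaum1986Invent, §I.12–I.14 and §I.17]
[cite: SilvermanAEC2009, VIII.8 Cor. 8.3] -/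
theorem katoDivisibility_negTwoSplitTwist_two_of_descent_of_L_one_ne_zero (h12 : Kato2004.thm12_4)
    (hDesc : Kato2004.exists_splitTwistDivisibilityInputsDescent_negOne_two)
    (h114 : Greenberg1999_thm114_charIdeal_iota_invariant)
    (h114F : Greenberg1999.thm114_charIdeal_iota_invariant_splitMult_baseChange) (h15 : thm15_isTorsion_multiplicative_rat)
    (hmod : hasEntireLFunction_rat)
    (W : WeierstrassCurve ℚ) [W.IsElliptic] [W.IsGloballyMinimal]
    (hsp : (W.quadraticTwist (-2)).HasSplitMultiplicativeReductionAtPrime 2) (hL : W.entireLFunction 1 ≠ 0)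
    (κ : ZpExtension ℚ 2) (γ : absoluteGaloisGroup ℚ) (hκ : κ.IsCyclotomic) (hγ : κ.IsTopGenerator γ)
    (hγ' : IsCyclotomicVariable 2 γ) {N : ℕ} [NeZero N] (f : CuspForm (Gamma0 N) 2)
    (hf : IsNewformOf (W.quadraticTwist (-2)) f) :
    ∃ Lt : IwasawaAlgebra 2,
      iwasawaToPowerSeries 2 Lt = padicLFunctionMinusBranchMultTwist f (1 : ℚ_[2]) 1 (-1) ∧ Lt ≠ 0 ∧
    (∀ (D : W.SelmerDualData κ γ) (𝔮 : PrimeSpectrum (IwasawaAlgebra 2)), 𝔮.asIdeal.height = 1 →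
      PowerSeries.C (2 : ℤ_[2]) ∉ 𝔮.asIdeal →
      lengthAt (IwasawaAlgebra 2) D.X 𝔮 ≤ lengthAt (IwasawaAlgebra 2) (IwasawaAlgebra 2 ⧸ Ideal.span {Lt}) 𝔮) ∧
    (∀ (D' : W.SelmerDualData κ γ⁻¹) (𝔮 : PrimeSpectrum (IwasawaAlgebra 2)), 𝔮.asIdeal.height = 1 →
      PowerSeries.C (2 : ℤ_[2]) ∉ 𝔮.asIdeal →
      lengthAt (IwasawaAlgebra 2) D'.X 𝔮 ≤ lengthAt (IwasawaAlgebra 2) (IwasawaAlgebra 2 ⧸ Ideal.span {Lt}) 𝔮) ∧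
    (∀ (W₁ : WeierstrassCurve ℚ) [W₁.IsElliptic], IsIsogenous W W₁ →
      ∀ (D₁ : W₁.SelmerDualData κ γ) (𝔮 : PrimeSpectrum (IwasawaAlgebra 2)), 𝔮.asIdeal.height = 1 →
      PowerSeries.C (2 : ℤ_[2]) ∉ 𝔮.asIdeal →
      lengthAt (IwasawaAlgebra 2) D₁.X 𝔮 ≤ lengthAt (IwasawaAlgebra 2) (IwasawaAlgebra 2 ⧸ Ideal.span {Lt}) 𝔮) := by
  haveI : Fact (Nat.Prime 2) := ⟨Nat.prime_two⟩
  haveI : ContinuousSMul ℤ_[2] (W.tateModule 2) := TateModule.continuousSMul_padicInt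
  haveI : (W.quadraticTwist (-2 : ℚ)).IsElliptic := W.isElliptic_quadraticTwist (by norm_num)
  obtain ⟨W', _, _, V, hV⟩ := exists_isGloballyMinimal_smul_eq_quadraticTwist W (d := -2) (by norm_num)
  -- (α) the twisted odd-branch integral lift: `W ≅ (W^{(−2)})^{(−2)}` (`(−2)·(−2) = 1·2²`)
  have hWtw : ∃ C : VariableChange ℚ, C • (W.quadraticTwist (-2 : ℚ)).quadraticTwist (-2) = W := by
    obtain ⟨C, hC⟩ := W.exists_variableChange_quadraticTwist_one
    obtain ⟨C₂, hC₂⟩ := W.exists_variableChange_quadraticTwist_mul_sq (1 : ℚ) (2 : ℚ) two_ne_zero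
    refine ⟨C⁻¹ * C₂⁻¹, ?_⟩
    rw [quadraticTwist_quadraticTwist, show (-2 : ℚ) * -2 = 1 * 2 ^ 2 by norm_num, ← hC₂, ← hC, mul_smul,
      inv_smul_smul, inv_smul_smul]
  obtain ⟨Lt, hLt, hLt0⟩ :=
    exists_iwasawa_lift_oddBranchTwist_ne_zero W (W.quadraticTwist (-2 : ℚ)) hWtw hf hsp hmod hL
  have hLt' : iwasawaToPowerSeries 2 Lt = padicLFunctionMinusBranchMultTwist f (1 : ℚ_[2]) 1 (-1) := by
    rw [hLt, pow_zero, map_one, one_mul]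
  -- (β) a model `F` of `ℚ(√−2)`, a square root `θ` of `−2` in `ℚ̄`, and `W′` split multiplicative above `2` over `F`
  obtain ⟨F, _, _, θF, hθF, hF2⟩ := exists_numberField_sq_eq_of_neg (d := -2) (by norm_num)
  obtain ⟨θ, hθ⟩ := AddKatoTwoQuadLayer.exists_sqrt (-2)
  haveI : (kerStab κ θ).Normal := normal_kerStab κ hθ
  have hsp' : W'.HasSplitMultiplicativeReductionAtPrime 2 :=
    hasSplitMultiplicativeReductionAtPrime_twistModel W W' (by norm_num) hV 2 hsp
  have hF : ∀ v : HeightOneSpectrum (𝓞 F), (2 : 𝓞 F) ∈ v.asIdeal → (W'.baseChange F).HasSplitMultiplicativeReductionAt v :=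
    fun v hv ↦ AddKatoTwoQuadLayerModel.hasSplitMultiplicativeReductionAt_baseChange_of_two_mem W' hsp' F v hv
  have hF2' : Module.finrank ℚ F = 2 := hF2
  -- (γ) the three clauses at every generator `γ₀` matching the cyclotomic variable and FIXING `√−2`
  have key : ∀ γ₀ : absoluteGaloisGroup ℚ, κ.IsTopGenerator γ₀ → IsCyclotomicVariable 2 γ₀ → γ₀ • θ = θ →
      (∀ (D : W.SelmerDualData κ γ₀) (𝔮 : PrimeSpectrum (IwasawaAlgebra 2)), 𝔮.asIdeal.height = 1 →
        PowerSeries.C (2 : ℤ_[2]) ∉ 𝔮.asIdeal →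
        lengthAt (IwasawaAlgebra 2) D.X 𝔮 ≤ lengthAt (IwasawaAlgebra 2) (IwasawaAlgebra 2 ⧸ Ideal.span {Lt}) 𝔮) ∧
      (∀ (D' : W.SelmerDualData κ γ₀⁻¹) (𝔮 : PrimeSpectrum (IwasawaAlgebra 2)), 𝔮.asIdeal.height = 1 →
        PowerSeries.C (2 : ℤ_[2]) ∉ 𝔮.asIdeal →
        lengthAt (IwasawaAlgebra 2) D'.X 𝔮 ≤ lengthAt (IwasawaAlgebra 2) (IwasawaAlgebra 2 ⧸ Ideal.span {Lt}) 𝔮) ∧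
      (∀ (W₁ : WeierstrassCurve ℚ) [W₁.IsElliptic], IsIsogenous W W₁ →
        ∀ (D₁ : W₁.SelmerDualData κ γ₀) (𝔮 : PrimeSpectrum (IwasawaAlgebra 2)), 𝔮.asIdeal.height = 1 →
        PowerSeries.C (2 : ℤ_[2]) ∉ 𝔮.asIdeal →
        lengthAt (IwasawaAlgebra 2) D₁.X 𝔮 ≤ lengthAt (IwasawaAlgebra 2) (IwasawaAlgebra 2 ⧸ Ideal.span {Lt}) 𝔮) := by
    intro γ₀ hγ₀ hγ₀' hγ₀θ
    obtain ⟨κF, γF, hκF, hγF, -, -, ΘS, hΘS⟩ := AddKatoTwoQuadLayerTwist.exists_selmerInfty_model_of_sq_eq κ hκ W' hθ hγ₀ hγ₀θ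
      (by norm_num : (-2 : ℚ) < 0) F hθF hF2'
    have hD := lengthAt_selmerDual_le_of_splitTwistDescent_negTwo_fe_of_model W W' hV hθ f κ γ₀ hsp hκ hγ₀ hγ₀' hγ₀θ hf F hF
      κF γF hκF hγF ((W'.baseChange F).selmerDualData κF hγF) ΘS hΘS Lt 0 hLt hLt0 hDesc h12 h114 h114F h15
    refine ⟨hD, ?_, ?_⟩
    · exact lengthAt_selmerDualContra_le_of_splitTwistDescent_negTwo_fe_of_model W W' hV hθ f κ γ₀ hsp hκ hγ₀ hγ₀' hγ₀θ hf F
        hF κF γF hκF hγF ((W'.baseChange F).selmerDualData κF hγF) ΘS hΘS Lt 0 hLt hLt0 hDesc h12 h114 h114F h15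
    · intro W₁ _ hiso D₁ 𝔮 h𝔮 hp𝔮
      have hp𝔮' : PowerSeries.C ((2 : ℕ) : ℤ_[2]) ∉ 𝔮.asIdeal := by exact_mod_cast hp𝔮
      rw [← lengthAt_selmerDual_eq_of_isIsogenous hiso (W.selmerDualData κ hγ₀) D₁ 𝔮 hp𝔮']
      exact hD (W.selmerDualData κ hγ₀) 𝔮 h𝔮 hp𝔮
  -- (δ) the WLOG: `γ` or `γ·c` fixes `√−2` (`c ∈ ker κ` a complex conjugation), then every datum re-keyed
  refine ⟨Lt, hLt', hLt0, ?_⟩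
  rcases QuadraticTwistSelmer.smul_sqrt_eq_or_eq_neg hθ γ with hγθ | hγθ
  · exact key γ hγ hγ' hγθ
  · obtain ⟨c, hc, hcθ⟩ :=
      AddKatoTwoQuadLayer.exists_mem_kerSubgroup_smul_sqrt_eq_neg_of_neg κ (by norm_num : (-2 : ℚ) < 0) hθ
    have hγcθ : (γ * c) • θ = θ := by rw [mul_smul, hcθ, smul_neg, hγθ, neg_neg]
    obtain ⟨h1, h2, h3⟩ := key (γ * c) (isTopGenerator_mul_of_mem_kerSubgroup κ hγ hc)
      (isCyclotomicVariable_mul_of_mem_kerSubgroup κ hκ hγ' hc) hγcθ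
    have h2c : PowerSeries.C ((2 : ℕ) : ℤ_[2]) = PowerSeries.C (2 : ℤ_[2]) := by norm_num
    refine ⟨?_, ?_, ?_⟩
    · have h := forall_selmerDualData_of_rekey (W₀ := W) Lt hc (by simpa only [h2c] using h1)
      simpa only [h2c] using h
    · have h := forall_selmerDualData_inv_of_mul (W₀ := W) Lt hc (by simpa only [h2c] using h2)
      simpa only [h2c] using h
    · intro W₁ _ hiso
      have h := forall_selmerDualData_of_rekey (W₀ := W₁) Lt hc (by simpa only [h2c] using h3 W₁ hiso)
      simpa only [h2c] using h

end Summit.BirchSwinnertonDyer.BirchSwinnertonDyer.Theorems.AddKatoTwo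

end
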